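import Summits.Ventures.LatticeQCDFlow.Exactness.FlowSamplerOperator
import Mathlib.MeasureTheory.Integral.IntervalIntegral.FundThmCalculus
import Mathlib.MeasureTheory.Integral.DominatedConvergence
import HarnessLib

/-!
# The rejection curve of the flow sampler: `λ(v)`, the weight-level masses, `λ = P̃ − Π/v`, and `λ(a) − λ(c) = ∫ Π(u⁻)/u²`

HONEST FRAMING: exact (Metropolis-corrected) sampling algorithms for lattice gauge theory;
figures of merit are autocorrelation/cost numbers at stated couplings and volumes; no
continuum-physics claim.  (SCALAR calibration rung S0-A: not a gauge result.)

Venture `LatticeQCDFlow` (cell pub-lqcd), topic `Exactness`; FANOUT row 2 (`s0-phi4`, FLOW arm).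
NEW WORK of the cell over Mathlib and row 2's `Exactness/FlowSamplerOperator.lean` (`imhAcceptQ`).
Nothing is cited as a fact.  First leg of the cell's proof of the Smith–Tierney exact `n`-step
kernel of the independence sampler (Smith–Tierney 1996; Theorem 5 of G. Wang, arXiv:2008.02455 —
NAMED ONLY, proved in the following files): the dynamics is a function of the importance weight
`b = w/q` through the REJECTION CURVE `λ(v) = ∫ (1 − min(1, b/v)) q dμ`.

## What is proved (general `(X, μ)`; `w, q > 0` measurable integrable; `b = w/q`)

* `rejCurve`, `massBelow` (`Π(u⁻) = ∫ 1[b < u] w`), `massLe` (`Π(u) = ∫ 1[b ≤ u] w`), `qMassLe`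
  (`P̃(v) = ∫ 1[b ≤ v] q`); **`rejection_eq_rejCurve`** — the sampler's rejection probability from `x`
  is `λ(b(x))`; bounds `0 ≤ λ ≤ ∫ q`, `0 ≤ Π(u⁻) ≤ Π(u) ≤ Z`; `rejCurve_mono`, `massBelow_mono`,
  `massLe_mono`; **`rejCurve_eq_qMassLe_sub`** `λ(v) = P̃(v) − Π(v)/v`;
* `integral_div_sq` (`∫_s^t b/u² = b/s − b/t`), `rej_integrand_sub_eq` (pointwise layer cake
  `(1 − min(1,b/a)) − (1 − min(1,b/c)) = ∫_c^a 1[b < u] b/u² du`) and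
  **`rejCurve_sub_eq`**: `λ(a) − λ(c) = ∫_c^a Π(u⁻)/u² du` for `0 < c ≤ a` (Fubini).

Continuity and the right derivative `λ'(u⁺) = Π(u)/u²` are in `Exactness/IMHRejectionCurveDeriv.lean`.
NOT CLAIMED here: anything about autocorrelations (see `IMHSmithTierneyKernel`).
-/

namespace Summit.Ventures.LatticeQCDFlow.Exactness

open Real MeasureTheory Filter Set Topology intervalIntegral

variable {X : Type*} [MeasurableSpace X] {μ : Measure X} {w q : X → ℝ}

/-! ## Definitions -/
/-- The REJECTION CURVE: the probability that a proposal `z ∼ q dμ` is rejected from a state of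
importance weight `v` (`b = w/q`): `λ(v) = ∫ (1 − min(1, b(z)/v)) q(z) dμ(z)`. -/
noncomputable def rejCurve (μ : Measure X) (w q : X → ℝ) (v : ℝ) : ℝ :=
  ∫ z, (1 - min 1 (w z / q z / v)) * q z ∂μ

/-- Target mass STRICTLY below weight level `u`: `Π(u⁻) = ∫ 1[b(z) < u] w(z) dμ(z)`. -/
noncomputable def massBelow (μ : Measure X) (w q : X → ℝ) (u : ℝ) : ℝ :=
  ∫ z, (if w z / q z < u then w z else 0) ∂μ

/-- Target mass at or below weight level `u`: `Π(u) = ∫ 1[b(z) ≤ u] w(z) dμ(z)`. -/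
noncomputable def massLe (μ : Measure X) (w q : X → ℝ) (u : ℝ) : ℝ :=
  ∫ z, (if w z / q z ≤ u then w z else 0) ∂μ

/-! ## The sampler's rejection probability is the curve evaluated at the current weight -/
omit [MeasurableSpace X] in
/-- `1 − α(x,z) = 1 − min(1, b(z)/b(x))`. -/
theorem one_sub_imhAcceptQ_eq (hw0 : ∀ t, 0 < w t) (hq0 : ∀ t, 0 < q t) (x z : X) :
    1 - imhAcceptQ w q x z = 1 - min 1 (w z / q z / (w x / q x)) := by
  unfold imhAcceptQ
  congr 2
  have hwx := (hw0 x).ne'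
  have hqx := (hq0 x).ne'
  have hqz := (hq0 z).ne'
  field_simp

/-- **`r(x) = λ(b(x))`**: the rejection probability from `x` is the rejection curve at `b(x) = w(x)/q(x)`. -/
theorem rejection_eq_rejCurve (hw0 : ∀ t, 0 < w t) (hq0 : ∀ t, 0 < q t) (x : X) :
    ∫ z, (1 - imhAcceptQ w q x z) * q z ∂μ = rejCurve μ w q (w x / q x) := by
  unfold rejCurve
  refine integral_congr_ae (Eventually.of_forall fun z => ?_)
  show (1 - imhAcceptQ w q x z) * q z = (1 - min 1 (w z / q z / (w x / q x))) * q z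
  rw [one_sub_imhAcceptQ_eq hw0 hq0]

/-! ## Elementary bounds and monotonicity -/
omit [MeasurableSpace X] in
/-- For `v > 0` the integrand `(1 − min(1, b/v)) q` lies in `[0, q]`. -/
theorem rejCurve_integrand_bounds (hw0 : ∀ t, 0 < w t) (hq0 : ∀ t, 0 < q t) {v : ℝ} (hv : 0 < v)
    (z : X) :
    0 ≤ (1 - min 1 (w z / q z / v)) * q z ∧ (1 - min 1 (w z / q z / v)) * q z ≤ q z := by
  have h1 : min 1 (w z / q z / v) ≤ 1 := min_le_left _ _
  have h0 : 0 ≤ min 1 (w z / q z / v) :=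
    le_min zero_le_one (div_nonneg (div_nonneg (hw0 z).le (hq0 z).le) hv.le)
  constructor
  · exact mul_nonneg (sub_nonneg.2 h1) (hq0 z).le
  · nlinarith [hq0 z]

/-- Measurability of the integrand in `z`. -/
theorem measurable_rejCurve_integrand (hwm : Measurable w) (hqm : Measurable q) (v : ℝ) :
    Measurable fun z => (1 - min 1 (w z / q z / v)) * q z :=
  (measurable_const.sub (measurable_const.min ((hwm.div hqm).div_const v))).mul hqm

/-- The integrand is integrable (`v > 0`). -/
theorem integrable_rejCurve_integrand (hw0 : ∀ t, 0 < w t) (hwm : Measurable w)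
    (hq0 : ∀ t, 0 < q t) (hqm : Measurable q) (hqi : Integrable q μ) {v : ℝ} (hv : 0 < v) :
    Integrable (fun z => (1 - min 1 (w z / q z / v)) * q z) μ := by
  refine Integrable.mono' hqi (measurable_rejCurve_integrand hwm hqm v).aestronglyMeasurable
    (Eventually.of_forall fun z => ?_)
  obtain ⟨h0, h1⟩ := rejCurve_integrand_bounds hw0 hq0 hv z
  rw [Real.norm_eq_abs, abs_of_nonneg h0]
  exact h1

/-- `0 ≤ λ(v) ≤ ∫ q` (`= 1` for a probability density) for `v > 0`. -/
theorem rejCurve_bounds (hw0 : ∀ t, 0 < w t) (hq0 : ∀ t, 0 < q t) (hqi : Integrable q μ) {v : ℝ}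
    (hv : 0 < v) : 0 ≤ rejCurve μ w q v ∧ rejCurve μ w q v ≤ ∫ z, q z ∂μ := by
  unfold rejCurve
  exact ⟨integral_nonneg fun z => (rejCurve_integrand_bounds hw0 hq0 hv z).1,
    integral_mono_of_nonneg (Eventually.of_forall fun z => (rejCurve_integrand_bounds hw0 hq0 hv z).1)
      hqi (Eventually.of_forall fun z => (rejCurve_integrand_bounds hw0 hq0 hv z).2)⟩

/-- **`λ` is nondecreasing on `(0, ∞)`**: a heavier current state rejects more. -/
theorem rejCurve_mono (hw0 : ∀ t, 0 < w t) (hwm : Measurable w) (hq0 : ∀ t, 0 < q t)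
    (hqm : Measurable q) (hqi : Integrable q μ) {c a : ℝ} (hc : 0 < c) (hca : c ≤ a) :
    rejCurve μ w q c ≤ rejCurve μ w q a := by
  unfold rejCurve
  refine integral_mono (integrable_rejCurve_integrand hw0 hwm hq0 hqm hqi hc)
    (integrable_rejCurve_integrand hw0 hwm hq0 hqm hqi (hc.trans_le hca)) fun z => ?_
  have hb : 0 ≤ w z / q z := div_nonneg (hw0 z).le (hq0 z).le
  have : w z / q z / a ≤ w z / q z / c := div_le_div_of_nonneg_left hb hc hca
  exact mul_le_mul_of_nonneg_right (by linarith [min_le_min_left (1:ℝ) this]) (hq0 z).le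

/-- Measurability of the level-set integrand (strict). -/
theorem measurable_massBelow_integrand (hwm : Measurable w) (hqm : Measurable q) (u : ℝ) :
    Measurable fun z => (if w z / q z < u then w z else 0 : ℝ) :=
  Measurable.ite (measurableSet_lt (hwm.div hqm) measurable_const) hwm measurable_const

/-- Measurability of the level-set integrands (non-strict). -/
theorem measurable_massLe_integrand (hwm : Measurable w) (hqm : Measurable q) (u : ℝ) :
    Measurable fun z => (if w z / q z ≤ u then w z else 0 : ℝ) :=
  Measurable.ite (measurableSet_le (hwm.div hqm) measurable_const) hwm measurable_const

omit [MeasurableSpace X] in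
/-- Pointwise bounds `0 ≤ 1[b < u] w ≤ 1[b ≤ u] w ≤ w`. -/
theorem mass_integrand_bounds (hw0 : ∀ t, 0 < w t) (u : ℝ) (z : X) :
    0 ≤ (if w z / q z < u then w z else 0 : ℝ)
    ∧ (if w z / q z < u then w z else 0 : ℝ) ≤ (if w z / q z ≤ u then w z else 0)
    ∧ (if w z / q z ≤ u then w z else 0 : ℝ) ≤ w z := by
  refine ⟨?_, ?_, ?_⟩
  · split_ifs
    · exact (hw0 z).le
    · exact le_rfl
  · by_cases h : w z / q z < u
    · rw [if_pos h, if_pos h.le]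
    · rw [if_neg h]
      split_ifs
      · exact (hw0 z).le
      · exact le_rfl
  · split_ifs
    · exact le_rfl
    · exact (hw0 z).le

/-- Integrability of the level-set integrands. -/
theorem integrable_mass_integrands (hw0 : ∀ t, 0 < w t) (hwm : Measurable w) (hwi : Integrable w μ)
    (hqm : Measurable q) (u : ℝ) :
    Integrable (fun z => (if w z / q z < u then w z else 0 : ℝ)) μ
    ∧ Integrable (fun z => (if w z / q z ≤ u then w z else 0 : ℝ)) μ := by
  constructor
  · refine Integrable.mono' hwi (measurable_massBelow_integrand hwm hqm u).aestronglyMeasurable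
      (Eventually.of_forall fun z => ?_)
    obtain ⟨h0, h1, h2⟩ := mass_integrand_bounds (q := q) hw0 u z
    rw [Real.norm_eq_abs, abs_of_nonneg h0]
    exact h1.trans h2
  · refine Integrable.mono' hwi (measurable_massLe_integrand hwm hqm u).aestronglyMeasurable
      (Eventually.of_forall fun z => ?_)
    obtain ⟨h0, h1, h2⟩ := mass_integrand_bounds (q := q) hw0 u z
    rw [Real.norm_eq_abs, abs_of_nonneg (h0.trans h1)]
    exact h2

/-- The masses below a level lie in `[0, Z]`, the strict one below the non-strict one. -/
theorem massBelow_bounds (hw0 : ∀ t, 0 < w t) (hwm : Measurable w) (hwi : Integrable w μ)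
    (hqm : Measurable q) (u : ℝ) :
    0 ≤ massBelow μ w q u ∧ massBelow μ w q u ≤ massLe μ w q u
    ∧ massLe μ w q u ≤ ∫ z, w z ∂μ := by
  obtain ⟨iB, iL⟩ := integrable_mass_integrands hw0 hwm hwi hqm u
  unfold massBelow massLe
  refine ⟨integral_nonneg fun z => (mass_integrand_bounds (q := q) hw0 u z).1,
    integral_mono iB iL fun z => (mass_integrand_bounds (q := q) hw0 u z).2.1,
    integral_mono iL hwi fun z => (mass_integrand_bounds (q := q) hw0 u z).2.2⟩

/-- `massBelow` is nondecreasing. -/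
theorem massBelow_mono (hw0 : ∀ t, 0 < w t) (hwm : Measurable w) (hwi : Integrable w μ)
    (hqm : Measurable q) : Monotone (massBelow μ w q) := by
  intro u u' huu'
  obtain ⟨iB, -⟩ := integrable_mass_integrands hw0 hwm hwi hqm u
  obtain ⟨iB', -⟩ := integrable_mass_integrands hw0 hwm hwi hqm u'
  unfold massBelow
  refine integral_mono iB iB' fun z => ?_
  by_cases h : w z / q z < u
  · rw [if_pos h, if_pos (h.trans_le huu')]
  · rw [if_neg h]
    split_ifs
    · exact (hw0 z).le
    · exact le_rfl

/-- `massLe` is nondecreasing. -/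
theorem massLe_mono (hw0 : ∀ t, 0 < w t) (hwm : Measurable w) (hwi : Integrable w μ)
    (hqm : Measurable q) : Monotone (massLe μ w q) := by
  intro u u' huu'
  obtain ⟨-, iL⟩ := integrable_mass_integrands hw0 hwm hwi hqm u
  obtain ⟨-, iL'⟩ := integrable_mass_integrands hw0 hwm hwi hqm u'
  unfold massLe
  refine integral_mono iL iL' fun z => ?_
  by_cases h : w z / q z ≤ u
  · rw [if_pos h, if_pos (h.trans huu')]
  · rw [if_neg h]
    split_ifs
    · exact (hw0 z).le
    · exact le_rfl

/-- Proposal mass at or below weight level `v`: `P̃(v) = ∫ 1[b(z) ≤ v] q(z) dμ(z)`. -/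
noncomputable def qMassLe (μ : Measure X) (w q : X → ℝ) (v : ℝ) : ℝ :=
  ∫ z, (if w z / q z ≤ v then q z else 0) ∂μ

/-- Measurability of the `q`-level-set integrand. -/
theorem measurable_qMassLe_integrand (hwm : Measurable w) (hqm : Measurable q) (v : ℝ) :
    Measurable fun z => (if w z / q z ≤ v then q z else 0 : ℝ) :=
  Measurable.ite (measurableSet_le (hwm.div hqm) measurable_const) hqm measurable_const

/-- Integrability and bounds of the `q`-level-set integrand: `0 ≤ 1[b ≤ v] q ≤ q`. -/
theorem integrable_qMassLe_integrand (hwm : Measurable w) (hq0 : ∀ t, 0 < q t)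
    (hqm : Measurable q) (hqi : Integrable q μ) (v : ℝ) :
    Integrable (fun z => (if w z / q z ≤ v then q z else 0 : ℝ)) μ
    ∧ (∀ z, 0 ≤ (if w z / q z ≤ v then q z else 0 : ℝ))
    ∧ (∀ z, (if w z / q z ≤ v then q z else 0 : ℝ) ≤ q z) := by
  have h0 : ∀ z, 0 ≤ (if w z / q z ≤ v then q z else 0 : ℝ) := fun z => by
    split_ifs; exacts [(hq0 z).le, le_rfl]
  have h1 : ∀ z, (if w z / q z ≤ v then q z else 0 : ℝ) ≤ q z := fun z => by
    split_ifs; exacts [le_rfl, (hq0 z).le]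
  refine ⟨Integrable.mono' hqi (measurable_qMassLe_integrand hwm hqm v).aestronglyMeasurable
    (Eventually.of_forall fun z => ?_), h0, h1⟩
  rw [Real.norm_eq_abs, abs_of_nonneg (h0 z)]
  exact h1 z

/-- **`λ(v) = P̃(v) − Π(v)/v`** (`v > 0`): rejection happens exactly against lighter proposals,
each rejected with probability `1 − b/v`. -/
theorem rejCurve_eq_qMassLe_sub (hw0 : ∀ t, 0 < w t) (hwm : Measurable w) (hwi : Integrable w μ)
    (hq0 : ∀ t, 0 < q t) (hqm : Measurable q) (hqi : Integrable q μ) {v : ℝ} (hv : 0 < v) :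
    rejCurve μ w q v = qMassLe μ w q v - massLe μ w q v / v := by
  obtain ⟨hiq, -, -⟩ := integrable_qMassLe_integrand hwm hq0 hqm hqi v
  obtain ⟨-, hiw⟩ := integrable_mass_integrands hw0 hwm hwi hqm v
  unfold rejCurve qMassLe massLe
  rw [div_eq_mul_inv, ← MeasureTheory.integral_mul_const, ← integral_sub hiq (hiw.mul_const _)]
  refine integral_congr_ae (Eventually.of_forall fun z => ?_)
  have hqz : q z ≠ 0 := (hq0 z).ne'
  have hvne : v ≠ 0 := hv.ne'
  show (1 - min 1 (w z / q z / v)) * q z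
    = (if w z / q z ≤ v then q z else 0) - (if w z / q z ≤ v then w z else 0) * v⁻¹
  by_cases h : w z / q z ≤ v
  · rw [if_pos h, if_pos h, min_eq_right ((div_le_one hv).2 h)]
    field_simp
  · rw [if_neg h, if_neg h, min_eq_left ((one_le_div hv).2 (not_le.1 h).le)]
    ring

/-! ## The integral representation `λ(a) − λ(c) = ∫_c^a Π(u⁻)/u² du` -/
/-- `∫_s^t b/u² du = b/s − b/t` for `0 < s ≤ t`. -/
theorem integral_div_sq {s t : ℝ} (hs : 0 < s) (hst : s ≤ t) (b : ℝ) :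
    ∫ u in s..t, b / u ^ 2 = b / s - b / t := by
  have hderiv : ∀ u ∈ uIcc s t, HasDerivAt (fun u : ℝ => -b * u⁻¹) (b / u ^ 2) u := by
    intro u hu
    rw [uIcc_of_le hst] at hu
    have hu0 : u ≠ 0 := (hs.trans_le hu.1).ne'
    have h := (hasDerivAt_inv hu0).const_mul (-b)
    have e : -b * -(u ^ 2)⁻¹ = b / u ^ 2 := by
      field_simp
    rw [e] at h
    exact h
  have hcont : ContinuousOn (fun u : ℝ => b / u ^ 2) (uIcc s t) := by
    refine ContinuousOn.div continuousOn_const (continuousOn_id.pow 2) fun u hu => ?_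
    rw [uIcc_of_le hst] at hu
    exact pow_ne_zero 2 (hs.trans_le hu.1).ne'
  rw [integral_eq_sub_of_hasDerivAt hderiv (hcont.intervalIntegrable)]
  have ht0 : t ≠ 0 := (hs.trans_le hst).ne'
  have hs0 : s ≠ 0 := hs.ne'
  field_simp
  ring

/-- The layer integrand `1[b < u] b/u²` is interval-integrable on `[c, a] ⊂ (0, ∞)`. -/
theorem intervalIntegrable_rejLayer {c a : ℝ} (hc : 0 < c) (hca : c ≤ a) (b : ℝ) :
    IntervalIntegrable (fun u : ℝ => if b < u then b / u ^ 2 else 0) volume c a := by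
  have hcont : ContinuousOn (fun u : ℝ => b / u ^ 2) (uIcc c a) := by
    refine ContinuousOn.div continuousOn_const (continuousOn_id.pow 2) fun u hu => ?_
    rw [uIcc_of_le hca] at hu
    exact pow_ne_zero 2 (hc.trans_le hu.1).ne'
  have h1 : IntervalIntegrable (fun u : ℝ => b / u ^ 2) volume c a := hcont.intervalIntegrable
  rw [intervalIntegrable_iff] at h1 ⊢
  have e : (fun u : ℝ => if b < u then b / u ^ 2 else 0) = (Ioi b).indicator fun u => b / u ^ 2 := by
    funext u
    simp only [Set.indicator_apply, Set.mem_Ioi]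
  rw [e]
  exact h1.indicator measurableSet_Ioi

/-- **Pointwise layer cake of the rejection integrand**: for `0 < c ≤ a` and any `b`,
`(1 − min(1, b/a)) − (1 − min(1, b/c)) = ∫_c^a 1[b < u] b/u² du`. -/
theorem rej_integrand_sub_eq {c a : ℝ} (hc : 0 < c) (hca : c ≤ a) (b : ℝ) :
    (1 - min 1 (b / a)) - (1 - min 1 (b / c)) = ∫ u in c..a, (if b < u then b / u ^ 2 else 0) := by
  have ha : 0 < a := hc.trans_le hca
  rcases le_or_gt b c with hbc | hcb
  · -- `b ≤ c`: the integrand is `b/u²` on `(c, a]`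
    have e : ∫ u in c..a, (if b < u then b / u ^ 2 else 0) = ∫ u in c..a, b / u ^ 2 := by
      refine intervalIntegral.integral_congr_ae (Eventually.of_forall fun u hu => ?_)
      rw [uIoc_of_le hca] at hu
      rw [if_pos (hbc.trans_lt hu.1)]
    rw [e, integral_div_sq hc hca, min_eq_right ((div_le_one ha).2 (hbc.trans hca)),
      min_eq_right ((div_le_one hc).2 hbc)]
    ring
  · rcases le_or_gt a b with hab | hba
    · -- `b ≥ a`: the integrand vanishes on `(c, a]`
      have e : ∫ u in c..a, (if b < u then b / u ^ 2 else 0) = ∫ u in c..a, (0:ℝ) := by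
        refine intervalIntegral.integral_congr_ae (Eventually.of_forall fun u hu => ?_)
        rw [uIoc_of_le hca] at hu
        rw [if_neg (not_lt.2 (hu.2.trans hab))]
      rw [e, intervalIntegral.integral_zero, min_eq_left ((one_le_div ha).2 hab),
        min_eq_left ((one_le_div hc).2 hcb.le)]
      ring
    · -- `c < b < a`: split at `b`
      have hb0 : 0 < b := hc.trans hcb
      rw [← intervalIntegral.integral_add_adjacent_intervals (intervalIntegrable_rejLayer hc hcb.le b)
        (intervalIntegrable_rejLayer hb0 hba.le b)]
      have e1 : ∫ u in c..b, (if b < u then b / u ^ 2 else 0) = ∫ u in c..b, (0:ℝ) := by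
        refine intervalIntegral.integral_congr_ae (Eventually.of_forall fun u hu => ?_)
        rw [uIoc_of_le hcb.le] at hu
        rw [if_neg (not_lt.2 hu.2)]
      have e2 : ∫ u in b..a, (if b < u then b / u ^ 2 else 0) = ∫ u in b..a, b / u ^ 2 := by
        refine intervalIntegral.integral_congr_ae (Eventually.of_forall fun u hu => ?_)
        rw [uIoc_of_le hba.le] at hu
        rw [if_pos hu.1]
      rw [e1, e2, intervalIntegral.integral_zero, integral_div_sq hb0 hba.le,
        min_eq_right ((div_le_one ha).2 hba.le), min_eq_left ((one_le_div hc).2 hcb.le),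
        div_self hb0.ne']
      ring

/-- Joint measurability of the layer integrand `(z, u) ↦ 1[b(z) < u] w(z)/u²`. -/
theorem measurable_rejLayer (hwm : Measurable w) (hqm : Measurable q) :
    Measurable fun p : ℝ × X => (if w p.2 / q p.2 < p.1 then w p.2 / p.1 ^ 2 else 0 : ℝ) :=
  Measurable.ite (measurableSet_lt ((hwm.div hqm).comp measurable_snd) measurable_fst)
    ((hwm.comp measurable_snd).div (measurable_fst.pow_const 2)) measurable_const

variable [SFinite μ]

/-- **INTEGRAL REPRESENTATION OF THE REJECTION CURVE**: for `0 < c ≤ a`,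
`λ(a) − λ(c) = ∫_c^a Π(u⁻)/u² du`, `Π(u⁻) = ∫ 1[b < u] w dμ` (Fubini on the pointwise layer cake;
`b q = w`). -/
theorem rejCurve_sub_eq (hw0 : ∀ t, 0 < w t) (hwm : Measurable w) (hwi : Integrable w μ)
    (hq0 : ∀ t, 0 < q t) (hqm : Measurable q) (hqi : Integrable q μ) {c a : ℝ} (hc : 0 < c)
    (hca : c ≤ a) :
    rejCurve μ w q a - rejCurve μ w q c = ∫ u in c..a, massBelow μ w q u / u ^ 2 := by
  unfold rejCurve massBelow
  rw [← integral_sub (integrable_rejCurve_integrand hw0 hwm hq0 hqm hqi (hc.trans_le hca))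
    (integrable_rejCurve_integrand hw0 hwm hq0 hqm hqi hc)]
  have e1 : ∀ z, (1 - min 1 (w z / q z / a)) * q z - (1 - min 1 (w z / q z / c)) * q z
      = ∫ u in c..a, (if w z / q z < u then w z / u ^ 2 else 0) := by
    intro z
    rw [← sub_mul, rej_integrand_sub_eq hc hca (w z / q z),
      ← intervalIntegral.integral_mul_const]
    refine intervalIntegral.integral_congr_ae (Eventually.of_forall fun u _ => ?_)
    have hqz : q z ≠ 0 := (hq0 z).ne'
    split_ifs
    · field_simp
    · exact zero_mul _
  simp_rw [e1]
  -- Fubini: `∫ z, ∫ u in c..a, F u z = ∫ u in c..a, ∫ z, F u z`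
  have hF : Integrable (Function.uncurry fun (u : ℝ) (z : X) =>
      (if w z / q z < u then w z / u ^ 2 else 0 : ℝ)) ((volume.restrict (uIoc c a)).prod μ) := by
    have hmeas := measurable_rejLayer (X := X) hwm hqm
    have hG : Integrable (fun p : ℝ × X => (1 / c ^ 2) * w p.2)
        ((volume.restrict (uIoc c a)).prod μ) := by
      have h1 : Integrable (fun _ : ℝ => (1 / c ^ 2 : ℝ)) (volume.restrict (uIoc c a)) := by
        rw [uIoc_of_le hca]
        exact integrable_const _
      exact h1.mul_prod hwi
    refine Integrable.mono' hG hmeas.aestronglyMeasurable ?_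
    rw [Measure.restrict_prod_eq_prod_univ, ae_restrict_iff' (measurableSet_uIoc.prod MeasurableSet.univ)]
    refine Eventually.of_forall fun p hp => ?_
    obtain ⟨hu, -⟩ := hp
    rw [uIoc_of_le hca] at hu
    show ‖(if w p.2 / q p.2 < p.1 then w p.2 / p.1 ^ 2 else 0 : ℝ)‖ ≤ 1 / c ^ 2 * w p.2
    rw [Real.norm_eq_abs]
    split_ifs
    · rw [abs_of_nonneg (div_nonneg (hw0 _).le (sq_nonneg _))]
      have hcp : c ^ 2 ≤ p.1 ^ 2 := pow_le_pow_left₀ hc.le hu.1.le 2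
      calc w p.2 / p.1 ^ 2 ≤ w p.2 / c ^ 2 :=
            div_le_div_of_nonneg_left (hw0 _).le (pow_pos hc 2) hcp
        _ = 1 / c ^ 2 * w p.2 := by ring
    · rw [abs_zero]
      exact mul_nonneg (by positivity) (hw0 _).le
  rw [← intervalIntegral_integral_swap hF]
  refine intervalIntegral.integral_congr_ae (Eventually.of_forall fun u hu => ?_)
  rw [uIoc_of_le hca] at hu
  have hu0 : u ^ 2 ≠ 0 := pow_ne_zero 2 (hc.trans hu.1).ne'
  rw [eq_div_iff hu0, ← MeasureTheory.integral_mul_const]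
  refine integral_congr_ae (Eventually.of_forall fun z => ?_)
  show (if w z / q z < u then w z / u ^ 2 else 0 : ℝ) * u ^ 2 = (if w z / q z < u then w z else 0)
  split_ifs
  · exact div_mul_cancel₀ _ hu0
  · exact zero_mul _

end Summit.Ventures.LatticeQCDFlow.Exactness
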